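import Literature.AlgebraicGeometry.Resolution.PrimeDivisors
import Literature.AlgebraicGeometry.Resolution.DivisorialPlace
import Literature.RingTheory.RegularLocalRing.QuotientDVR
import Mathlib.RingTheory.RegularLocalRing.Defs
import Mathlib.RingTheory.Ideal.Height
import Summits.ResolutionOfSingularities.ResolutionOfSingularities.Theorems.AffineToGlobal.Negative.OneShotHypothesis
import HarnessLib

/-!
# An exceptional place on a regular chart is the place of a height-one prime
(crux `RuledResidues.NonRuledCofinite`, stmt-ResolutionOfSingularities-18076, line `regular-atlas`,
stub `stub_exceptionalCentre`)

Pure commutative algebra inside a field `K ⊇ k`. Let `R ≤ B ⊆ W` with `B` a finitely generated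
REGULAR `k`-subalgebra of `K` with `Frac B = K` and `W` a valuation ring of `K`, and let
`𝔭 = 𝔪_W ∩ B` be the centre of `W` on `B` (`Literature.AlgebraicGeometry.Resolution.centreIdeal`).
Suppose

* (`Sing` clause) the centre of `W` on `R` is a non-regular point: `R_{𝔪_W ∩ R}` is not a regular
  local ring, and
* (no good model) `W` dominates no regular local ring of dimension `≥ 2` of an affine model
  `A ⊆ W` (`A` finitely generated over `k`, `Frac A = K`).

Then `ht 𝔭 = 1` and `W = B_𝔭` elementwise: `z ∈ W ↔ z = a / s` with `a, s ∈ B`, `s ∉ 𝔭`.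

Proof (the height trichotomy of the centre on a regular chart). The local ring `B_𝔭` is regular
(`IsRegularRing B`) of Krull dimension `ht 𝔭` (`IsLocalization.AtPrime.ringKrullDim_eq_height`).
* `ht 𝔭 ≥ 2` is excluded by the no-good-model clause with `A := B`.
* `ht 𝔭 = 0` means `𝔭 = 0` (`Ideal.height_eq_zero_iff_eq_bot`), hence the centre `𝔪_W ∩ R = 0`
  as well, and `R_{(0)}` — a localisation of a domain at the zero ideal — is a field, hence a
  regular local ring (reused from the tree:
  `Theorems.AffineToGlobal.Negative.isRegularLocalRing_localization_bot`); this contradicts the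
  `Sing` clause.
* `ht 𝔭 = 1`: then `B_𝔭` is a regular local ring of dimension one, i.e. a discrete valuation ring
  (`Literature.RingTheory.RegularLocalRing.isDiscreteValuationRing_of_ringKrullDim_eq_one`,
  Matsumura, *Commutative Ring Theory*, Thm. 11.2), and a valuation ring of `K` dominating the
  discrete valuation ring `B_𝔭 ⊆ K = Frac B_𝔭` equals it
  (`Literature.AlgebraicGeometry.Resolution.mem_iff_exists_eq_div_of_primeDivisor`,
  Zariski–Samuel II, Ch. VI §14, proof of Thm. 31: "`K_v = R_𝔭`").

No new definitions; everything is proved (`[folklore]`).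
-/

-- single-problem summit: the doubled namespace component is forced
set_option linter.dupNamespace false

noncomputable section

open IsLocalRing
open Literature.AlgebraicGeometry.Resolution

namespace Summit.ResolutionOfSingularities.ResolutionOfSingularities.Theorems.RuledResiduesNonRuledCofinite

/-- Regularity of the local ring `S_I` is invariant under (propositional) equality of the prime
`I`: the ideal is an index of the type `Localization.AtPrime I`, so one transports by `subst`.
[folklore] -/
theorem isRegularLocalRing_localizationAtPrime_congr {S : Type*} [CommRing S] {I J : Ideal S}
    [I.IsPrime] [J.IsPrime] (e : I = J) :
    IsRegularLocalRing (Localization.AtPrime I) ↔ IsRegularLocalRing (Localization.AtPrime J) := by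
  subst e
  exact Iff.rfl

/-- For `R ≤ B ⊆ W`: if the centre `𝔪_W ∩ B` of `W` on `B` is zero, so is the centre `𝔪_W ∩ R` of
`W` on `R` (it is the contraction of the former). [folklore] -/
theorem comap_inclusion_maximalIdeal_eq_bot {k K : Type} [Field k] [Field K] [Algebra k K]
    {R B : Subalgebra k K} (hRB : R ≤ B) (W : ValuationSubring K)
    (hBW : B.toSubring ≤ W.toSubring) (hRW : R.toSubring ≤ W.toSubring)
    (hbot : centreIdeal B W hBW = ⊥) :
    Ideal.comap (Subring.inclusion hRW) (IsLocalRing.maximalIdeal W) = (⊥ : Ideal R) := by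
  refine (Submodule.eq_bot_iff _).mpr fun x hx => ?_
  have hxB : Subalgebra.inclusion hRB x ∈ centreIdeal B W hBW := hx
  rw [hbot, Ideal.mem_bot] at hxB
  exact Subalgebra.inclusion_injective hRB (hxB.trans (map_zero _).symm)

/-- **Stub `stub_exceptionalCentre` (line `regular-atlas` of crux `RuledResidues.NonRuledCofinite`):
an exceptional place on a regular chart is the place of its centre, a height-one prime.**
For a finitely generated regular `k`-subalgebra `B ⊇ R` of `K` with `Frac B = K` inside a
valuation ring `W` of `K`: if the centre of `W` on `R` is a non-regular point (`R_{𝔪_W ∩ R}` not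
regular) and `W` dominates no regular local ring of dimension `≥ 2` of an affine model `A ⊆ W`,
then the centre `𝔭 = 𝔪_W ∩ B` has height one and `W = B_𝔭 = {a / s | a ∈ B, s ∈ B ∖ 𝔭}`.
(`B_𝔭` is regular of dimension `ht 𝔭`; `ht 𝔭 ≥ 2` contradicts the no-good-model clause with
`A := B`; `ht 𝔭 = 0` gives `𝔭 = 0`, so the centre on `R` is `0` and `R_(0)` is a field, hence
regular, contradicting the `Sing` clause; `ht 𝔭 = 1` makes `B_𝔭` a discrete valuation ring
(Matsumura, CRT, Thm. 11.2) and then `W = B_𝔭` (Zariski–Samuel II, VI §14, Thm. 31, proof).)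
[folklore] -/
theorem stub_exceptionalCentre (k K : Type) [Field k] [Field K] [Algebra k K] (R B : Subalgebra k K)
    (hRB : R ≤ B) (hB : B.FG) (hBfr : IsFractionRing B K) (hreg : IsRegularRing B)
    (W : ValuationSubring K) (hBW : B.toSubring ≤ W.toSubring)
    (hsing : ∃ h : R.toSubring ≤ W.toSubring, ¬ IsRegularLocalRing (Localization.AtPrime
      (Ideal.comap (Subring.inclusion h) (IsLocalRing.maximalIdeal W))))
    (hexc : ¬ ∃ A : Subalgebra k K, A.FG ∧ IsFractionRing A K ∧ ∃ h : A.toSubring ≤ W.toSubring,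
      IsRegularLocalRing (Localization.AtPrime
        (Ideal.comap (Subring.inclusion h) (IsLocalRing.maximalIdeal W))) ∧
      (2 : WithBot ℕ∞) ≤ ringKrullDim (Localization.AtPrime
        (Ideal.comap (Subring.inclusion h) (IsLocalRing.maximalIdeal W)))) :
    (centreIdeal B W hBW).height = 1 ∧
      ∀ z : K, z ∈ W ↔ ∃ a s : B, s ∉ centreIdeal B W hBW ∧ z = a / s := by
  haveI := hreg
  haveI := hBfr
  -- the regular local ring `B_𝔭` at the centre, of dimension `ht 𝔭`
  have hregp : IsRegularLocalRing (Localization.AtPrime (centreIdeal B W hBW)) := inferInstance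
  have hdim : ringKrullDim (Localization.AtPrime (centreIdeal B W hBW)) =
      (centreIdeal B W hBW).height :=
    IsLocalization.AtPrime.ringKrullDim_eq_height (centreIdeal B W hBW)
      (Localization.AtPrime (centreIdeal B W hBW))
  have hht : (centreIdeal B W hBW).height = 1 := by
    by_cases h0 : (centreIdeal B W hBW).height = 0
    · -- `𝔭 = 0`: the centre on `R` is `0`, `R_(0)` is a field — contradicts the `Sing` clause
      exfalso
      have hbot : centreIdeal B W hBW = ⊥ := Ideal.height_eq_zero_iff_eq_bot.mp h0
      obtain ⟨hRW, hnreg⟩ := hsing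
      apply hnreg
      rw [isRegularLocalRing_localizationAtPrime_congr
        (comap_inclusion_maximalIdeal_eq_bot hRB W hBW hRW hbot)]
      -- `Summit.ResolutionOfSingularities.ResolutionOfSingularities.Theorems.AffineToGlobal.Negative`
      exact Theorems.AffineToGlobal.Negative.isRegularLocalRing_localization_bot R
    by_cases h1 : (centreIdeal B W hBW).height = 1
    · exact h1
    · -- `ht 𝔭 ≥ 2`: `B` itself is a good model — contradicts the no-good-model clause
      exfalso
      have h2 : (2 : ℕ∞) ≤ (centreIdeal B W hBW).height := by
        have h1le : (1 : ℕ∞) ≤ (centreIdeal B W hBW).height := Order.one_le_iff_ne_zero.mpr h0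
        have h1lt : (1 : ℕ∞) < (centreIdeal B W hBW).height := lt_of_le_of_ne h1le (Ne.symm h1)
        have h11 : (1 : ℕ∞) + 1 ≤ (centreIdeal B W hBW).height :=
          (ENat.add_one_le_iff ENat.one_ne_top).mpr h1lt
        rwa [one_add_one_eq_two] at h11
      apply hexc
      refine ⟨B, hB, hBfr, hBW, hregp, ?_⟩
      change (2 : WithBot ℕ∞) ≤ ringKrullDim (Localization.AtPrime (centreIdeal B W hBW))
      rw [hdim]
      have h2' : ((2 : ℕ∞) : WithBot ℕ∞) ≤ (centreIdeal B W hBW).height := WithBot.coe_le_coe.mpr h2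
      exact (WithBot.coe_ofNat (α := ℕ∞) 2).ge.trans h2'
  refine ⟨hht, fun z => ?_⟩
  -- `ht 𝔭 = 1`: `B_𝔭` is a discrete valuation ring and `W = B_𝔭`
  have hdim1 : ringKrullDim (Localization.AtPrime (centreIdeal B W hBW)) = 1 := by
    rw [hdim, hht]
    rfl
  have hD : IsDiscreteValuationRing (Localization.AtPrime (centreIdeal B W hBW)) :=
    Literature.RingTheory.RegularLocalRing.isDiscreteValuationRing_of_ringKrullDim_eq_one hdim1
  exact mem_iff_exists_eq_div_of_primeDivisor W B hBW hD z

end Summit.ResolutionOfSingularities.ResolutionOfSingularities.Theorems.RuledResiduesNonRuledCofinite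

end
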